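import Mathlib

/-!
# T12 (census r1): the rational 2-isogenies of the Frey curve halve / double the archimedean proximity

For `E : y² = x(x−a)(x+b) = x(x² + (b−a)x − ab)` and a curve `y² = x(x² + αx + β)` one has
`c₄ = 16(α² − 3β)`, `Δ = 16β²(α² − 4β)`, `j = 256(α²−3β)³/(β²(α²−4β))`, and the quotient by `(0,0)` is
`y² = x(x² − 2αx + (α² − 4β))` (Silverman AEC III Ex. 4.5). The identities below give
`j(E) = 256(a²+ab+b²)³/(abc)²`, `j(E/⟨(0,0)⟩) = −16(a²−14ab+b²)³/(abc⁴)`, `Δ(E/⟨(0,0)⟩) = −256·abc⁴`,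
`j(E/⟨(a,0)⟩) = 16(a²+14ac+c²)³/(ab⁴c)`: for a deep triple (`a ≪ b ≈ c`) `log|j|` drops from `≈ 2·log(c/a)` to
`≈ log(c/a)` under two of the three rational 2-isogenies and doubles under the third (`E/⟨(−b,0)⟩`, by `a ↔ b`).
-/

-- j(E): α = b - a, β = -ab
example (a b : ℚ) : (b - a) ^ 2 - 3 * (-(a * b)) = a ^ 2 + a * b + b ^ 2 := by ring
example (a b : ℚ) : (b - a) ^ 2 - 4 * (-(a * b)) = (a + b) ^ 2 := by ring
-- E' = E/⟨(0,0)⟩: α' = -2(b-a), β' = (b-a)² + 4ab = c²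
example (a b : ℚ) : (-2 * (b - a)) ^ 2 - 3 * (a + b) ^ 2 = a ^ 2 - 14 * a * b + b ^ 2 := by ring
example (a b : ℚ) : (-2 * (b - a)) ^ 2 - 4 * (a + b) ^ 2 = -(16 * a * b) := by ring
-- Δ(E') = 16 β'² (α'² − 4β') = −256 a b c⁴ with c = a + b
example (a b : ℚ) : 16 * ((a + b) ^ 2) ^ 2 * ((-2 * (b - a)) ^ 2 - 4 * (a + b) ^ 2) = -256 * a * b * (a + b) ^ 4 := by
  ring
-- E'' = E/⟨(a,0)⟩: shift x ↦ x + a gives x(x+a)(x+c) = x(x² + (a+c)x + ac); quotient: α'' = -2(a+c), β'' = (a+c)² − 4ac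
example (a c : ℚ) : (a + c) ^ 2 - 4 * (a * c) = (c - a) ^ 2 := by ring
example (a c : ℚ) : (-2 * (a + c)) ^ 2 - 3 * (c - a) ^ 2 = a ^ 2 + 14 * a * c + c ^ 2 := by ring
example (a c : ℚ) : (-2 * (a + c)) ^ 2 - 4 * (c - a) ^ 2 = 16 * a * c := by ring
example (a c : ℚ) : 16 * ((c - a) ^ 2) ^ 2 * ((-2 * (a + c)) ^ 2 - 4 * (c - a) ^ 2) = 256 * a * (c - a) ^ 4 * c := by
  ring
-- Hecke conservation bookkeeping at level ℓ (the ℓ+1 index-ℓ superlattices of ⟨1, iy⟩ have Im-parts ℓy and y/ℓ (ℓ times)):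
example (ℓ y : ℚ) (hℓ : ℓ ≠ 0) : ℓ * y + ℓ * (y / ℓ) = (ℓ + 1) * y := by field_simp
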